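import Summits.CriticalPhenomena.PercolationContinuityZ3.Theorems.Transplant.FKConnectivityAllQArborealClusterTools
import Literature.Probability.Percolation.KozmaNitzanPreFKG
import HarnessLib

/-!
# The arboreal gas — forest-MM ⇒ forest-CA ⇒ Ayyer–Linusson–Ravichandran's Conjecture 7.1 (Harris' induction on the pairs at the tree)

Support file (`--supports stmt-CriticalPhenomena-4575`), FK sub-lane `prim-bschramm-fk-1` (gen 9) of the post-continuity programme;
builds on p205010 (kernel theorem, internal audit signed; external expert review pending).  No definitions, no named facts, no sorries;
standard axioms.  Nodes: `…ArborealAuxDefs.lean` (`ArborealClusterDomAdjOn` = forest-MM, `ArborealClusterAssocOn` = forest-CA),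
`…ArborealDefs.lean` (`ArborealHubPos` = ALR Conj. 7.1).

THEOREM (`arborealClusterAssocOn_of_clusterDomAdjOn`): on every finite vertex type, forest-MM (the tree `T_x` of the arboreal gas is
positively correlated with the presence of each pair at `x`, for all up-set functionals) implies forest-CA (the law of `T_x` is positively
associated); hence (`hubUnder_agMeasure_of_clusterAssocOn`, `arborealHubPos_of_clusterDomAdjPos`) forest-MM alone implies ALR's
Conjecture 7.1 `μ^F(o ↔ a)μ^F(b ↔ a) ≤ μ^F(o ↔ a ↔ b)` for the arboreal gas on every finite weighted graph — the forest twin of fk-1 g8's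
MM ⇒ CA ⇒ hub for `φ_{w,q}`.  PROOF: Harris' inequality by induction on the number of undetermined pairs, revealing pairs at the weight-1
tree of `x` (one-point decomposition `agE_opd`; the cross term `P·Q·(a₁ − a₀)(b₁ − b₀)` is signed by forest-MM at the surely-joined
vertex, transported to `x` on the support; base case = deterministic tree).  The homogeneous forms make the degenerate measures
(`Z_for = 0`) harmless.  Census (fk-1 g8, exact): forest-MM 0 violations / 5,400; forest hub 0 / 27,000 (this seat, `n ≤ 7`).
[cite: Grimmett2006, Thm. (2.19) proof (pp. 26–27); Thm. (3.7) (p. 39); §3.9 (pp. 63–65)]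
[cite: AyyerLinussonRavichandran2025, §7 eq. (15), Conj. 7.1 (p. 22)]
-/

noncomputable section

namespace Summit.CriticalPhenomena.PercolationContinuityZ3.Theorems

namespace FK

open MeasureTheory Set Literature.Probability.LatticeModels Literature.Probability.Percolation
open scoped Classical
open BHK2006 DecisionTree HullPort

variable {V : Type*} [Fintype V] (w : Sym2 V → unitInterval)

/-! ### forest-MM ⇒ forest-CA (Harris' induction on the pairs at the tree) -/

/-- The inductive step of Harris' inequality in homogeneous form: a combination of two associated pairs whose cross term is signed.
[cite: Grimmett2006, Thm. (2.19) proof (pp. 26–27)] -/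
theorem ag_assoc_step {P Q a₁ a₀ b₁ b₀ c₁ c₀ m₁ m₀ : ℝ} (hP : 0 ≤ P) (hQ : 0 ≤ Q) (hPQ : P + Q = 1)
    (hm₁ : m₁ ≤ 1) (hm₀ : m₀ ≤ 1) (hc₁ : 0 ≤ c₁) (hc₀ : 0 ≤ c₀)
    (h₁ : a₁ * b₁ ≤ m₁ * c₁) (h₀ : a₀ * b₀ ≤ m₀ * c₀) (cross : 0 ≤ P * Q * ((a₁ - a₀) * (b₁ - b₀))) :
    (P * a₁ + Q * a₀) * (P * b₁ + Q * b₀) ≤ 1 * (P * c₁ + Q * c₀) := by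
  have h₁' : a₁ * b₁ ≤ c₁ := h₁.trans (by nlinarith)
  have h₀' : a₀ * b₀ ≤ c₀ := h₀.trans (by nlinarith)
  have hQ' : Q = 1 - P := by linarith
  subst hQ'
  nlinarith [mul_nonneg hP (sub_nonneg.2 h₁'), mul_nonneg hQ (sub_nonneg.2 h₀'), cross]

/-- **forest-MM ⇒ forest-CA, inductive form**: under `ArborealClusterDomAdjOn V`, for every parameter vector with `n` undetermined pairs the
law of every tree `T_x` under the arboreal gas is positively associated (homogeneous form). [cite: Grimmett2006, Thm. (2.19) proof (pp. 26–27); Thm. (3.7) (p. 39)] -/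
theorem arborealClusterAssoc_aux (h : ArborealClusterDomAdjOn V) :
    ∀ (n : ℕ) (u : Sym2 V → unitInterval), (undet u).card = n → ∀ (x : V) (𝒰 𝒱 : Set (Set V)),
      IsUpperSet 𝒰 → IsUpperSet 𝒱 →
        (agMeasure u).real (clusterIn x 𝒰) * (agMeasure u).real (clusterIn x 𝒱) ≤
          (agMeasure u).real univ * (agMeasure u).real (clusterIn x 𝒰 ∩ clusterIn x 𝒱) := by
  intro n
  induction n using Nat.strong_induction_on with
  | _ n ih =>
    intro u hn x 𝒰 𝒱 h𝒰 h𝒱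
    -- the degenerate measure: everything vanishes
    rcases agMeasure_real_univ_eq_one_or u with hm | hm
    swap
    · have h0 : ∀ D : Set (BondConfig V), (agMeasure u).real D = 0 := fun D =>
        le_antisymm ((agMeasure_real_eq_agE u D).symm ▸ (hm ▸ agE_ind_le_univ u D)) measureReal_nonneg
      rw [h0 (clusterIn x 𝒰), zero_mul, hm, zero_mul]
    by_cases hcase : ∃ f ∈ cut {x} (oneSet u), f ∈ undet u
    · -- an undetermined pair `f ∋ v` meets the weight-1 tree of `x` at `v`
      obtain ⟨f, ⟨v, hvf, x', hx', hxv⟩, hfu⟩ := hcase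
      rw [mem_singleton_iff] at hx'
      subst hx'
      have hf : f = s(v, Sym2.Mem.other hvf) := (Sym2.other_spec hvf).symm
      set b := Sym2.Mem.other hvf with hb
      have hw1 : u f ≠ 1 := fun h1 => (mem_undet_iff u f).1 hfu (Or.inr h1)
      have reach : ∀ bb : Bool, (openGraph (oneSet (setW u f bb))).Reachable x' v := fun bb =>
        hxv.mono (openGraph_le (oneSet_subset_oneSet_setW u hw1 bb))
      -- one-point decompositions
      set P := agE u (ind {ω : BondConfig V | f ∈ ω}) with hP
      set Q := agE u (ind {ω : BondConfig V | f ∉ ω}) with hQ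
      have hP0 : 0 ≤ P := agE_nonneg u fun ω => ind_nonneg _ _
      have hQ0 : 0 ≤ Q := agE_nonneg u fun ω => ind_nonneg _ _
      have hPQ : P + Q = 1 := by rw [hP, hQ, agE_ind_mem_add, hm]
      have eA : (agMeasure u).real (clusterIn x' 𝒰) =
          P * (agMeasure (setW u f true)).real (clusterIn x' 𝒰) + Q * (agMeasure (setW u f false)).real (clusterIn x' 𝒰) := by
        rw [agMeasure_real_eq_agE, agMeasure_real_eq_agE, agMeasure_real_eq_agE]; exact agE_opd u f _
      have eB : (agMeasure u).real (clusterIn x' 𝒱) =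
          P * (agMeasure (setW u f true)).real (clusterIn x' 𝒱) + Q * (agMeasure (setW u f false)).real (clusterIn x' 𝒱) := by
        rw [agMeasure_real_eq_agE, agMeasure_real_eq_agE, agMeasure_real_eq_agE]; exact agE_opd u f _
      have eAB : (agMeasure u).real (clusterIn x' 𝒰 ∩ clusterIn x' 𝒱) =
          P * (agMeasure (setW u f true)).real (clusterIn x' 𝒰 ∩ clusterIn x' 𝒱) +
            Q * (agMeasure (setW u f false)).real (clusterIn x' 𝒰 ∩ clusterIn x' 𝒱) := by
        rw [agMeasure_real_eq_agE, agMeasure_real_eq_agE, agMeasure_real_eq_agE]; exact agE_opd u f _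
      -- induction hypothesis for the two revealed vectors
      have hlt : ∀ bb : Bool, (undet (setW u f bb)).card < n := fun bb => by
        have h1 := card_undet_setW_le u hfu bb
        have hpos : 0 < (undet u).card := Finset.card_pos.2 ⟨f, hfu⟩
        omega
      have ih1 := ih _ (hlt true) (setW u f true) rfl x' 𝒰 𝒱 h𝒰 h𝒱
      have ih0 := ih _ (hlt false) (setW u f false) rfl x' 𝒰 𝒱 h𝒰 h𝒱
      have hm1 : (agMeasure (setW u f true)).real univ ≤ 1 := by
        rcases agMeasure_real_univ_eq_one_or (setW u f true) with h | h <;> rw [h]; exact zero_le_one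
      have hm0 : (agMeasure (setW u f false)).real univ ≤ 1 := by
        rcases agMeasure_real_univ_eq_one_or (setW u f false) with h | h <;> rw [h]; exact zero_le_one
      -- forest-MM at `v`, transported to `x'`, in the covariance form `P·Q·(a₁ − a₀) ≥ 0`
      have mmcov : ∀ (𝒲 : Set (Set V)), IsUpperSet 𝒲 →
          0 ≤ P * Q * ((agMeasure (setW u f true)).real (clusterIn x' 𝒲) - (agMeasure (setW u f false)).real (clusterIn x' 𝒲)) := by
        intro 𝒲 h𝒲
        -- MM at v for the pair f = s(v,b): μ(T_v ∈ 𝒲)·μ(f∈F) ≤ μ(Ω)·μ(T_v ∈ 𝒲, f ∈ F)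
        have key := h u v b 𝒲 h𝒲
        rw [← hf, hm, one_mul] at key
        -- transport T_v = T_x' on the support of μ_u
        have tr : ∀ S : Set (BondConfig V), (agMeasure u).real (clusterIn v 𝒲 ∩ S) = (agMeasure u).real (clusterIn x' 𝒲 ∩ S) := by
          intro S
          rw [agMeasure_real_eq_agE, agMeasure_real_eq_agE]
          refine agE_congr_support u fun ω hω => ?_
          rw [ind_inter, ind_inter, ag_ind_clusterIn_eq_of_oneSet_reachable u hxv 𝒲 hω]
        have tr0 : (agMeasure u).real (clusterIn v 𝒲) = (agMeasure u).real (clusterIn x' 𝒲) := by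
          have := tr univ; rwa [inter_univ, inter_univ] at this
        rw [tr, tr0] at key
        -- express both sides through the branches: μ(A ∩ J) = P·a₁ (`agMass_mul_ind_of_pointwise`), μ(J) = P, μ(A) = P a₁ + Q a₀
        have eJ : (agMeasure u).real {ω : BondConfig V | f ∈ ω} = P := by rw [hP, agMeasure_real_eq_agE]
        have eAJ : (agMeasure u).real (clusterIn x' 𝒲 ∩ {ω : BondConfig V | f ∈ ω}) =
            P * (agMeasure (setW u f true)).real (clusterIn x' 𝒲) := by
          rw [agMeasure_real_eq_agE, agMeasure_real_eq_agE, hP]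
          unfold agE
          rw [Finset.mul_sum]
          refine Finset.sum_congr rfl fun ω _ => ?_
          have e1 := agMass_mul_ind_of_pointwise u (agWeight_mul_ind_mem u f) ω
          unfold agE at e1
          rw [ind_inter, show agMass u ω * (ind (clusterIn x' 𝒲) ω * ind {ω : BondConfig V | f ∈ ω} ω) =
            (agMass u ω * ind {ω : BondConfig V | f ∈ ω} ω) * ind (clusterIn x' 𝒲) ω by ring, e1]
          ring
        have eAw : (agMeasure u).real (clusterIn x' 𝒲) =
            P * (agMeasure (setW u f true)).real (clusterIn x' 𝒲) + Q * (agMeasure (setW u f false)).real (clusterIn x' 𝒲) := by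
          rw [agMeasure_real_eq_agE, agMeasure_real_eq_agE, agMeasure_real_eq_agE]; exact agE_opd u f _
        rw [eJ, eAJ, eAw] at key
        -- key : (P a₁ + Q a₀) P ≤ P a₁  with P + Q = 1  ⇒  P Q (a₁ − a₀) ≥ 0
        have hQ' : Q = 1 - P := by linarith
        rw [hQ'] at key ⊢
        nlinarith [key]
      have cross : 0 ≤ P * Q * (((agMeasure (setW u f true)).real (clusterIn x' 𝒰) - (agMeasure (setW u f false)).real (clusterIn x' 𝒰)) *
          ((agMeasure (setW u f true)).real (clusterIn x' 𝒱) - (agMeasure (setW u f false)).real (clusterIn x' 𝒱))) := by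
        have hA := mmcov 𝒰 h𝒰
        have hB := mmcov 𝒱 h𝒱
        by_cases hPQ0 : P * Q = 0
        · rw [hPQ0]; simp
        · have hpos : 0 < P * Q := lt_of_le_of_ne (mul_nonneg hP0 hQ0) (Ne.symm hPQ0)
          have hA' : 0 ≤ (agMeasure (setW u f true)).real (clusterIn x' 𝒰) - (agMeasure (setW u f false)).real (clusterIn x' 𝒰) :=
            (mul_nonneg_iff_of_pos_left hpos).1 hA
          have hB' : 0 ≤ (agMeasure (setW u f true)).real (clusterIn x' 𝒱) - (agMeasure (setW u f false)).real (clusterIn x' 𝒱) :=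
            (mul_nonneg_iff_of_pos_left hpos).1 hB
          exact mul_nonneg hpos.le (mul_nonneg hA' hB')
      rw [eA, eB, eAB, hm]
      exact ag_assoc_step hP0 hQ0 hPQ hm1 hm0 measureReal_nonneg measureReal_nonneg ih1 ih0 cross
    · -- no undetermined pair meets the weight-1 tree: `T_x` is deterministic
      push Not at hcase
      have hA : ∀ f ∈ cut {x} (oneSet u), u f = 0 ∨ u f = 1 := fun f hf => by
        have := hcase f hf; rw [mem_undet_iff] at this; push Not at this
        exact this
      have hinter : clusterIn x 𝒰 ∩ clusterIn x 𝒱 = clusterIn x (𝒰 ∩ 𝒱) := by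
        ext ω; simp [clusterIn]
      rw [hinter, ag_real_clusterIn_of_determined u x hA 𝒰, ag_real_clusterIn_of_determined u x hA 𝒱,
        ag_real_clusterIn_of_determined u x hA (𝒰 ∩ 𝒱), ind_inter, hm]
      have h1 : ind 𝒰 (openCluster (oneSet u) x) ≤ 1 := by
        by_cases h : openCluster (oneSet u) x ∈ 𝒰
        · rw [ind_of_mem h]
        · rw [ind_of_not_mem h]; exact zero_le_one
      nlinarith [ind_nonneg 𝒰 (openCluster (oneSet u) x), ind_nonneg 𝒱 (openCluster (oneSet u) x), h1]

/-- **forest-MM ⇒ forest-CA**: stochastic monotonicity of the tree of a vertex in the pairs at that vertex implies positive association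
of the tree, for the arboreal gas on every finite weighted graph over `V`. [cite: Grimmett2006, Thm. (2.19) proof (pp. 26–27); §3.9 (pp. 63–65)]
[cite: AyyerLinussonRavichandran2025, §7 Conj. 7.1 (p. 22)] -/
theorem arborealClusterAssocOn_of_clusterDomAdjOn (h : ArborealClusterDomAdjOn V) : ArborealClusterAssocOn V :=
  fun u x 𝒰 𝒱 h𝒰 h𝒱 => arborealClusterAssoc_aux h _ u rfl x 𝒰 𝒱 h𝒰 h𝒱

/-- **forest-CA ⇒ the hub inequality for the arboreal gas** (ALR Conj. 7.1 on `V`): take the tree of the hub `a` and the up-sets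
`{S ∋ o}`, `{S ∋ b}`. [cite: AyyerLinussonRavichandran2025, §7 eq. (15), Conj. 7.1 (p. 22)] -/
theorem hubUnder_agMeasure_of_clusterAssocOn (h : ArborealClusterAssocOn V) (u : Sym2 V → unitInterval) (o a b : V) :
    HubUnder (agMeasure u) o a b := by
  unfold HubUnder
  have key := h u a {S | o ∈ S} {S | b ∈ S} (SoloBlindKN.isUpperSet_containing o) (SoloBlindKN.isUpperSet_containing b)
  rw [clusterIn_mem_eq_openConn, clusterIn_mem_eq_openConn, KNPreFKG.openConn_symm a o, KNPreFKG.openConn_symm a b] at key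
  exact key

/-- **Conjecture nodes: `ArborealClusterDomAdjPos → ArborealClusterAssocPos → ArborealHubPos`** — forest-MM alone implies ALR's
Conjecture 7.1. [cite: AyyerLinussonRavichandran2025, §7 Conj. 7.1 (p. 22)] -/
theorem arborealClusterAssocPos_of_clusterDomAdjPos (h : ArborealClusterDomAdjPos) : ArborealClusterAssocPos :=
  fun n => arborealClusterAssocOn_of_clusterDomAdjOn (h n)

/-- `ArborealClusterAssocPos → ArborealHubPos`. [cite: AyyerLinussonRavichandran2025, §7 Conj. 7.1 (p. 22)] -/
theorem arborealHubPos_of_clusterAssocPos (h : ArborealClusterAssocPos) : ArborealHubPos :=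
  fun n u o a b => hubUnder_agMeasure_of_clusterAssocOn (h n) u o a b

/-- **`ArborealClusterDomAdjPos → ArborealHubPos`.** [cite: AyyerLinussonRavichandran2025, §7 Conj. 7.1 (p. 22)] -/
theorem arborealHubPos_of_clusterDomAdjPos (h : ArborealClusterDomAdjPos) : ArborealHubPos :=
  arborealHubPos_of_clusterAssocPos (arborealClusterAssocPos_of_clusterDomAdjPos h)

end FK

end Summit.CriticalPhenomena.PercolationContinuityZ3.Theorems

end
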